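import Mathlib
import HarnessLib
import Summits.Langlands.Langlands.Theses.SkinnerWilesDefectOne
import Summits.Langlands.Langlands.Theorems.SkinnerWilesDefectOneEisensteinProModularSeedRestrictTwistGaloisPackageAux
import Summits.Langlands.Langlands.Theorems.SkinnerWilesDefectOneFiveIsogenyEllipticCurvesIntegralFrame
import Literature.NumberTheory.GaloisRepresentations.AbsGaloisOuterConj
import Literature.NumberTheory.GaloisRepresentations.SorensenPatching
import Literature.NumberTheory.GaloisRepresentations.ImaginaryQuadraticCyclotomicProofs
import Literature.NumberTheory.Automorphic.LanglandsTetrahedral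

/-!
# Item `SeedOfQuadraticBaseChange` (stmt-Langlands-15158, route `SkinnerWilesDefectOne`):
# descended ⟺ conjugation-invariant — auxiliary file (the two implications)

The closing compositions of the item landed so far
(`…SeedOfQuadraticBaseChange{,OddPrimes,SixFacts,CousinSplit}`) prove
`SeedOfQuadraticBaseChange : QuadraticBaseChangeGalois → EisensteinProModularSeed` modulo six named
facts and ONE open hypothesis, the seed crux VERBATIM on the residual pairs `(χ̄_a, χ̄_b)` of `ρ₀`
that are NOT odd-descended: no continuous unit-valued `η : Γ_ℚ → ℚ̄_pˣ` with `η̄(σ|_ℚ) χ̄_a(σ) = χ̄_b(σ)`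
on `Γ_F` and `η̄(c) = -1` (the line lead's `DescendsOdd`, skeleton v3–v5 of `descend-raise-basechange`).
This file and its sequel `…SeedOfQuadraticBaseChangeDescent` identify that population in closed
form.  Here, for `F` imaginary quadratic, `O = 𝒪_{ℚ̄_p}` and `ρ₀` a residually upper-triangular
integral model of a continuous `ρ`:

* `ratio_conjInvariant_of_descends` — if the ratio descends (any `η` with the descent relation),
  then the residual ratio `ψ̄ = χ̄_b/χ̄_a : Γ_F → κˣ` is invariant under the outer action of `Γ_ℚ`:
  `ψ̄(σ') = ψ̄(σ)` whenever `res σ' = τ · res σ · τ⁻¹` (cross-multiplied: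
  `(ρ₀σ')₁₁ (ρ₀σ)₀₀ ≡ (ρ₀σ')₀₀ (ρ₀σ)₁₁ (mod 𝔪)`);
* `descendsOdd_of_ratio_conjInvariant` — conversely, a `Γ_ℚ`-invariant ratio descends to an ODD
  `η`: extend the Teichmüller lift `ψ` of `ψ̄` from the index-two subgroup `res(Γ_F) ⊴ Γ_ℚ` by
  `η(c) := -1` at a complex conjugation `c` (`c ∉ res(Γ_F)` because `F` is totally complex, `c² = 1`,
  `ψ ∘ θ_c = ψ`), a continuous character since `res` is an open embedding; oddness at EVERY complex
  conjugation follows from their conjugacy (`IsComplexConjugation.isConj`).  Parity costs nothing: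
  the two extensions of `ψ̄` differ by the quadratic character of `F`, which is odd.

Group theory used on the way (`exists_extension_of_index_two`): an `A`-valued character `ψ` of a
subgroup `res : M ↪ G` of index two, invariant under conjugation by an involution `c ∉ res(M)`,
extends to `G` with `Φ(c) = 1`.
-/

set_option linter.dupNamespace false -- project-wide option (lakefile weak.linter.dupNamespace); `Summit.Langlands.Langlands` is the mandated namespace

noncomputable section

namespace Summit.Langlands.Langlands.Theorems.SkinnerWilesDefectOne.SeedOfQuadraticBaseChange

open Summit.Langlands.Langlands.Theorems.SkinnerWilesDefectOne.EisensteinProModularSeed.RestrictTwist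
  (exists_teichmuller finite_range_of_ker_mem_nhds)
open Summit.Langlands.Langlands.Theorems.EisensteinProModularSeed.Negative
  (entry_eq_of_integralModel mem_maximalIdeal_of_v_lt_one)
open Summit.Langlands.Langlands.Theorems.FiveIsogenyEllipticCurves (v_lt_one_of_mem_maximalIdeal mem_O_iff)
open Literature.NumberTheory.GaloisRepresentations Literature.NumberTheory.Automorphic
open NumberField IsLocalRing Filter Field Topology

/-! ### 1. Group theory: extending a conjugation-invariant character across index two -/

section GroupTheory

variable {G M A : Type*} [Group G] [Group M] [CommGroup A]

/-- **Extension across index two.**  Let `res : M ↪ G` be an injective homomorphism whose image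
has index `2`, `c ∈ G ∖ res(M)` with `c² = 1`, `θ : M → M` the conjugation by `c` pulled back
(`res (θ m) = c · res m · c⁻¹`), and `ψ : M → A` a homomorphism to a commutative group with
`ψ ∘ θ = ψ`.  Then `ψ` extends to `Φ : G → A` with `Φ(c) = 1` (namely `Φ(res m) = Φ(c · res m) = ψ m`;
multiplicativity is the four-case check using `G = res(M) ⊔ c · res(M)`).  Ref: Serre, *Linear
representations of finite groups*, §8.1 (extension of a stable character from a normal subgroup
with cyclic quotient). [folklore] -/
theorem exists_extension_of_index_two (res : M →* G) (hinj : Function.Injective res)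
    (hidx : res.range.index = 2) {c : G} (hc : c ∉ res.range) (hc2 : c * c = 1)
    (θ : M → M) (hθ : ∀ m, res (θ m) = c * res m * c⁻¹)
    (ψ : M →* A) (hψ : ∀ m, ψ (θ m) = ψ m) :
    ∃ Φ : G →* A, (∀ m, Φ (res m) = ψ m) ∧ Φ c = 1 := by
  classical
  set e : res.range ≃* M := (MonoidHom.ofInjective hinj).symm with he_def
  have hres_e : ∀ x : res.range, res (e x) = x := fun x => MonoidHom.apply_ofInjective_symm hinj x
  have he_res : ∀ m, e ⟨res m, m, rfl⟩ = m := fun m => hinj (hres_e _)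
  have hcinv : c⁻¹ = c := inv_eq_of_mul_eq_one_right hc2
  have hmul : ∀ {g : G}, g ∉ res.range → c * g ∈ res.range := fun {g} hg =>
    (Subgroup.mul_mem_iff_of_index_two hidx).mpr (iff_of_false hc hg)
  have hconj_mem : ∀ {x : G}, x ∈ res.range → c * x * c⁻¹ ∈ res.range := fun {x} hx => by
    obtain ⟨m, rfl⟩ := hx
    exact ⟨θ m, hθ m⟩
  have he_conj : ∀ (x : G) (hx : x ∈ res.range),
      e ⟨c * x * c⁻¹, hconj_mem hx⟩ = θ (e ⟨x, hx⟩) := fun x hx =>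
    hinj (by rw [hres_e, hθ, hres_e])
  -- the candidate extension
  let Φf : G → A := fun g =>
    if hg : g ∈ res.range then ψ (e ⟨g, hg⟩) else ψ (e ⟨c * g, hmul hg⟩)
  have hΦ_mem : ∀ (g : G) (hg : g ∈ res.range), Φf g = ψ (e ⟨g, hg⟩) := fun g hg => dif_pos hg
  have hΦ_nmem : ∀ (g : G) (hg : g ∉ res.range), Φf g = ψ (e ⟨c * g, hmul hg⟩) := fun g hg =>
    dif_neg hg
  have hΦ_mul : ∀ g g', Φf (g * g') = Φf g * Φf g' := by
    intro g g'
    by_cases hg : g ∈ res.range <;> by_cases hg' : g' ∈ res.range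
    · -- both in `res(M)`
      have hgg' : g * g' ∈ res.range := mul_mem hg hg'
      have hprod : (⟨g * g', hgg'⟩ : res.range) = ⟨g, hg⟩ * ⟨g', hg'⟩ := rfl
      rw [hΦ_mem _ hgg', hΦ_mem _ hg, hΦ_mem _ hg', hprod, map_mul, map_mul]
    · -- `g ∈ res(M)`, `g' ∉ res(M)`: `c g g' = (c g c⁻¹)(c g')`
      have hgg' : g * g' ∉ res.range := fun h => hg' (by simpa using mul_mem (inv_mem hg) h)
      have hprod : (⟨c * (g * g'), hmul hgg'⟩ : res.range) =
          ⟨c * g * c⁻¹, hconj_mem hg⟩ * ⟨c * g', hmul hg'⟩ := Subtype.ext (by simp [mul_assoc])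
      rw [hΦ_nmem _ hgg', hΦ_mem _ hg, hΦ_nmem _ hg', hprod, map_mul, map_mul, he_conj, hψ]
    · -- `g ∉ res(M)`, `g' ∈ res(M)`: `c g g' = (c g) g'`
      have hgg' : g * g' ∉ res.range := fun h => hg (by simpa using mul_mem h (inv_mem hg'))
      have hprod : (⟨c * (g * g'), hmul hgg'⟩ : res.range) = ⟨c * g, hmul hg⟩ * ⟨g', hg'⟩ :=
        Subtype.ext (by simp [mul_assoc])
      rw [hΦ_nmem _ hgg', hΦ_nmem _ hg, hΦ_mem _ hg', hprod, map_mul, map_mul]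
    · -- both outside: `g g' = (c (c g) c⁻¹)(c g')` since `c² = 1`
      have hgg' : g * g' ∈ res.range :=
        (Subgroup.mul_mem_iff_of_index_two hidx).mpr (iff_of_false hg hg')
      have hprod : (⟨g * g', hgg'⟩ : res.range) =
          ⟨c * (c * g) * c⁻¹, hconj_mem (hmul hg)⟩ * ⟨c * g', hmul hg'⟩ := by
        refine Subtype.ext ?_
        have hcc : ∀ x : G, c * (c * x) = x := fun x => by rw [← mul_assoc, hc2, one_mul]
        change g * g' = c * (c * g) * c⁻¹ * (c * g')
        simp only [hcinv, mul_assoc, hcc]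
      rw [hΦ_mem _ hgg', hΦ_nmem _ hg, hΦ_nmem _ hg', hprod, map_mul, map_mul, he_conj, hψ]
  refine ⟨MonoidHom.mk' Φf hΦ_mul, fun m => ?_, ?_⟩
  · change Φf (res m) = ψ m
    rw [hΦ_mem _ ⟨m, rfl⟩, he_res]
  · change Φf c = 1
    have h1 : (⟨c * c, hmul hc⟩ : res.range) = 1 := Subtype.ext hc2
    rw [hΦ_nmem _ hc, h1, map_one, map_one]

end GroupTheory

/-! ### 2. Valuation-ring bookkeeping for `O = 𝒪_{ℚ̄_p}` -/

section Valuation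

variable {p : ℕ} [Fact p.Prime] {O : ValuationSubring (PadicAlgCl p)}

/-- Units of `O = 𝒪_{ℚ̄_p}` have valuation `1`. [folklore] -/
theorem v_coe_units_eq_one (hO : O = (Valued.v : Valuation (PadicAlgCl p) NNReal).valuationSubring)
    (u : Oˣ) : Valued.v (((u : O) : PadicAlgCl p)) = 1 := by
  apply le_antisymm ((mem_O_iff hO).mp (u : O).2)
  have hinv : Valued.v (((u⁻¹ : Oˣ) : O) : PadicAlgCl p) ≤ 1 := (mem_O_iff hO).mp ((u⁻¹ : Oˣ) : O).2
  have hprod : Valued.v (((u : O) : PadicAlgCl p)) * Valued.v (((u⁻¹ : Oˣ) : O) : PadicAlgCl p) = 1 := by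
    rw [← map_mul]
    have h : ((u : O) : PadicAlgCl p) * (((u⁻¹ : Oˣ) : O) : PadicAlgCl p) = 1 := by
      rw [← Subring.coe_mul, ← Units.val_mul, mul_inv_cancel, Units.val_one]; rfl
    rw [h, map_one]
  by_contra hlt
  rw [not_le] at hlt
  have : Valued.v (((u : O) : PadicAlgCl p)) * Valued.v (((u⁻¹ : Oˣ) : O) : PadicAlgCl p) < 1 :=
    mul_lt_one_of_nonneg_of_lt_one_left zero_le hlt hinv
  exact this.ne hprod

end Valuation

/-! ### 3. The descended regime is the conjugation-invariant regime -/

section Descent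

variable {F : Type} [Field F] [NumberField F] {p : ℕ} [Fact p.Prime]
  {O : ValuationSubring (PadicAlgCl p)}
  {ρ : FramedGaloisRep F (PadicAlgCl p) 2}
  {ρ₀ : absoluteGaloisGroup F →* Matrix.GeneralLinearGroup (Fin 2) O}

/-- **Descended ⟹ conjugation-invariant.**  If some `η : Γ_ℚ → ℚ̄_pˣ` satisfies the descent
relation `η(σ|_ℚ) (ρ₀σ)₀₀ ≡ (ρ₀σ)₁₁ (mod 𝔪)` on `Γ_F`, then the residual ratio of `ρ₀` is invariant
under the outer action of `Γ_ℚ`: for `res σ' = τ · res σ · τ⁻¹`,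
`(ρ₀σ')₁₁ (ρ₀σ)₀₀ ≡ (ρ₀σ')₀₀ (ρ₀σ)₁₁ (mod 𝔪)` — since `η(res σ') = η(res σ) =: u` (the target is
commutative) and `d'a - a'd = (d' - u a') a + a' (u a - d)`. [folklore] -/
theorem ratio_conjInvariant_of_descends
    (hO : O = (Valued.v : Valuation (PadicAlgCl p) NNReal).valuationSubring)
    (η : absoluteGaloisGroup ℚ →ₜ* (PadicAlgCl p)ˣ)
    (hD : ∀ σ : absoluteGaloisGroup F,
      Valued.v (((η (absGaloisRestrict ℚ F σ) : (PadicAlgCl p)ˣ) : PadicAlgCl p) *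
          ((ρ₀ σ).val 0 0 : PadicAlgCl p) - ((ρ₀ σ).val 1 1 : PadicAlgCl p)) < 1)
    (τ : absoluteGaloisGroup ℚ) (σ σ' : absoluteGaloisGroup F)
    (h : absGaloisRestrict ℚ F σ' = τ * absGaloisRestrict ℚ F σ * τ⁻¹) :
    ((ρ₀ σ').val 1 1 * (ρ₀ σ).val 0 0 - (ρ₀ σ').val 0 0 * (ρ₀ σ).val 1 1 : O) ∈ maximalIdeal O := by
  apply mem_maximalIdeal_of_v_lt_one hO
  set u : PadicAlgCl p := ((η (absGaloisRestrict ℚ F σ) : (PadicAlgCl p)ˣ) : PadicAlgCl p) with hu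
  have hu' : ((η (absGaloisRestrict ℚ F σ') : (PadicAlgCl p)ˣ) : PadicAlgCl p) = u := by
    rw [h, map_mul, map_mul, map_inv, mul_inv_cancel_comm]
  set a : PadicAlgCl p := ((ρ₀ σ).val 0 0 : PadicAlgCl p)
  set d : PadicAlgCl p := ((ρ₀ σ).val 1 1 : PadicAlgCl p)
  set a' : PadicAlgCl p := ((ρ₀ σ').val 0 0 : PadicAlgCl p)
  set d' : PadicAlgCl p := ((ρ₀ σ').val 1 1 : PadicAlgCl p)
  have h₁ : Valued.v (u * a - d) < 1 := hD σ
  have h₂ : Valued.v (u * a' - d') < 1 := by rw [← hu']; exact hD σ'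
  have ha : Valued.v a ≤ 1 := (mem_O_iff hO).mp ((ρ₀ σ).val 0 0).2
  have ha' : Valued.v a' ≤ 1 := (mem_O_iff hO).mp ((ρ₀ σ').val 0 0).2
  have hid : (((ρ₀ σ').val 1 1 * (ρ₀ σ).val 0 0 - (ρ₀ σ').val 0 0 * (ρ₀ σ).val 1 1 : O) :
      PadicAlgCl p) = (d' - u * a') * a + a' * (u * a - d) := by
    push_cast
    ring
  rw [hid]
  refine Valuation.map_add_lt _ ?_ ?_
  · rw [map_mul, Valuation.map_sub_swap]
    exact mul_lt_one_of_nonneg_of_lt_one_left zero_le h₂ ha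
  · rw [map_mul]
    exact mul_lt_one_of_nonneg_of_lt_one_right ha' zero_le h₁

/-- **Conjugation-invariant ⟹ descended, with an ODD `η`** (`F` imaginary quadratic).  If the
residual ratio `ψ̄ = χ̄_b/χ̄_a` of `ρ₀` is invariant under the outer action of `Γ_ℚ` on `Γ_F`, then
there is a continuous unit-valued `η : Γ_ℚ → ℚ̄_pˣ` with `η̄(σ|_ℚ) χ̄_a(σ) = χ̄_b(σ)` on `Γ_F` and
`η̄(c) = -1` at every complex conjugation `c`.  Construction: `ψ :=` the Teichmüller lift of `ψ̄`
(finite image, `exists_teichmuller`), exactly `θ_c`-invariant; `res(Γ_F) ⊴ Γ_ℚ` has index `2`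
(`SorensenPatching.index_range_absGaloisRestrict`) and misses every complex conjugation `c`
(`F` totally complex), `c² = 1`; extend `ψ` by `Φ(c) = 1` (`exists_extension_of_index_two`) and put
`η := ε_F · Φ`, `ε_F` the sign character of `res(Γ_F)` (the quadratic character of `F`, odd);
continuity because `res` is an open embedding, oddness at all `c'` by `IsComplexConjugation.isConj`.
[folklore] -/
theorem descendsOdd_of_ratio_conjInvariant (hF : IsTotallyComplex F) (hdeg : Module.finrank ℚ F = 2)
    (hO : O = (Valued.v : Valuation (PadicAlgCl p) NNReal).valuationSubring)
    (hmod : ρ.HasUpperTriangularIntegralModel ρ₀)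
    (hinv : ∀ (τ : absoluteGaloisGroup ℚ) (σ σ' : absoluteGaloisGroup F),
      absGaloisRestrict ℚ F σ' = τ * absGaloisRestrict ℚ F σ * τ⁻¹ →
      ((ρ₀ σ').val 1 1 * (ρ₀ σ).val 0 0 - (ρ₀ σ').val 0 0 * (ρ₀ σ).val 1 1 : O) ∈ maximalIdeal O) :
    ∃ η : absoluteGaloisGroup ℚ →ₜ* (PadicAlgCl p)ˣ,
      (∀ τ, Valued.v ((η τ : (PadicAlgCl p)ˣ) : PadicAlgCl p) = 1) ∧
      (∀ σ : absoluteGaloisGroup F,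
        Valued.v (((η (absGaloisRestrict ℚ F σ) : (PadicAlgCl p)ˣ) : PadicAlgCl p) *
            ((ρ₀ σ).val 0 0 : PadicAlgCl p) - ((ρ₀ σ).val 1 1 : PadicAlgCl p)) < 1) ∧
      (∀ c : absoluteGaloisGroup ℚ, IsComplexConjugation (Rat.castHom ℝ) c →
        Valued.v (((η c : (PadicAlgCl p)ˣ) : PadicAlgCl p) + 1) < 1) := by
  classical
  haveI : Algebra.IsQuadraticExtension ℚ F := ⟨hdeg⟩
  haveI : IsGalois ℚ F := inferInstance
  -- the residual diagonal characters and their ratio `ψ̄ = χ̄_b / χ̄_a : Γ_F →* κˣ`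
  set χa : absoluteGaloisGroup F →* (ResidueField O)ˣ := (hmod.2.residualChar 0).toHomUnits
    with hχa_def
  set χb : absoluteGaloisGroup F →* (ResidueField O)ˣ := (hmod.2.residualChar 1).toHomUnits
    with hχb_def
  have hχa : ∀ g, ((χa g : (ResidueField O)ˣ) : ResidueField O) = residue O ((ρ₀ g).val 0 0) :=
    fun g => rfl
  have hχb : ∀ g, ((χb g : (ResidueField O)ˣ) : ResidueField O) = residue O ((ρ₀ g).val 1 1) :=
    fun g => rfl
  set ψbar : absoluteGaloisGroup F →* (ResidueField O)ˣ := χb / χa with hψbar_def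
  have hψbar : ∀ g, ψbar g = χb g / χa g := fun g => rfl
  -- `ψ̄` is invariant under the outer action of `Γ_ℚ`
  have hψbar_inv : ∀ (τ : absoluteGaloisGroup ℚ) (σ σ' : absoluteGaloisGroup F),
      absGaloisRestrict ℚ F σ' = τ * absGaloisRestrict ℚ F σ * τ⁻¹ → ψbar σ' = ψbar σ := by
    intro τ σ σ' h
    have hm := hinv τ σ σ' h
    rw [← residue_eq_zero_iff, map_sub, map_mul, map_mul, sub_eq_zero, ← hχa, ← hχb, ← hχa, ← hχb,
      ← Units.val_mul, ← Units.val_mul, Units.val_injective.eq_iff] at hm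
    rw [hψbar, hψbar, div_eq_div_iff_mul_eq_mul, hm, mul_comm]
  -- `ψ̄` has finite image: its kernel contains a neighbourhood of `1`
  have hker : (ψbar.ker : Set (absoluteGaloisGroup F)) ∈ nhds (1 : absoluteGaloisGroup F) := by
    have hc : ∀ i : Fin 2, Continuous fun g : absoluteGaloisGroup F => (ρ g).val i i := fun i =>
      (Units.continuous_val.comp ρ.continuous_toFun).matrix_elem i i
    have h1 : ∀ i : Fin 2, {y : PadicAlgCl p | Valued.v (y - 1) < 1} ∈ nhds ((ρ 1).val i i) := by
      intro i
      rw [map_one, Units.val_one, Matrix.one_apply_eq, Valued.mem_nhds]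
      exact ⟨1, fun y hy => by simpa using hy⟩
    refine Filter.mem_of_superset (Filter.inter_mem ((hc 0).continuousAt.preimage_mem_nhds (h1 0))
      ((hc 1).continuousAt.preimage_mem_nhds (h1 1))) fun g hg => ?_
    obtain ⟨hg0, hg1⟩ := hg
    change Valued.v ((ρ g).val 0 0 - 1) < 1 at hg0
    change Valued.v ((ρ g).val 1 1 - 1) < 1 at hg1
    have hone : ∀ i : Fin 2, Valued.v ((ρ g).val i i - 1) < 1 →
        residue O ((ρ₀ g).val i i) = 1 := by
      intro i hi
      rw [← (residue O).map_one, ← sub_eq_zero, ← map_sub, residue_eq_zero_iff]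
      apply mem_maximalIdeal_of_v_lt_one hO
      push_cast
      rw [← entry_eq_of_integralModel hmod g i i]
      exact hi
    change g ∈ ψbar.ker
    rw [MonoidHom.mem_ker, hψbar, div_eq_one, ← Units.val_injective.eq_iff, hχa, hχb, hone 0 hg0,
      hone 1 hg1]
  haveI : Finite ψbar.range := finite_range_of_ker_mem_nhds ψbar hker
  -- the Teichmüller lift `ψ` of `ψ̄`
  obtain ⟨T, n, hn, hTn, hTres⟩ := exists_teichmuller hO ψbar.range
  set ψ₀ : absoluteGaloisGroup F →* Oˣ := T.comp ψbar.rangeRestrict with hψ₀_def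
  set ψ : absoluteGaloisGroup F →* (PadicAlgCl p)ˣ := (Units.map O.subtype.toMonoidHom).comp ψ₀
    with hψ_def
  have hψ_coe : ∀ σ, ((ψ σ : (PadicAlgCl p)ˣ) : PadicAlgCl p) = ((ψ₀ σ : O) : PadicAlgCl p) :=
    fun σ => rfl
  have hψ_res : ∀ σ, residue O (ψ₀ σ : O) = ((ψbar σ : (ResidueField O)ˣ) : ResidueField O) := by
    intro σ
    rw [hψ₀_def, MonoidHom.comp_apply, hTres]
    rfl
  have hψ_v : ∀ σ, Valued.v ((ψ σ : (PadicAlgCl p)ˣ) : PadicAlgCl p) = 1 := fun σ => by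
    rw [hψ_coe]; exact v_coe_units_eq_one hO _
  have hψ_inv : ∀ (τ : absoluteGaloisGroup ℚ) (σ σ' : absoluteGaloisGroup F),
      absGaloisRestrict ℚ F σ' = τ * absGaloisRestrict ℚ F σ * τ⁻¹ → ψ σ' = ψ σ := by
    intro τ σ σ' h
    have hr : ψbar.rangeRestrict σ' = ψbar.rangeRestrict σ :=
      Subtype.ext (by rw [MonoidHom.coe_rangeRestrict, MonoidHom.coe_rangeRestrict,
        hψbar_inv τ σ σ' h])
    simp only [hψ_def, hψ₀_def, MonoidHom.comp_apply, hr]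
  -- `ψ` is trivial near `1`
  have hψ_one : ∀ g ∈ (ψbar.ker : Set (absoluteGaloisGroup F)), ψ g = 1 := by
    intro g hg
    change g ∈ ψbar.ker at hg
    rw [MonoidHom.mem_ker] at hg
    have hr : ψbar.rangeRestrict g = 1 := Subtype.ext (by rw [MonoidHom.coe_rangeRestrict, hg]; rfl)
    simp only [hψ_def, hψ₀_def, MonoidHom.comp_apply, hr, map_one]
  -- a complex conjugation `c ∉ res(Γ_F)`, `c² = 1`; `res(Γ_F)` has index two
  obtain ⟨c, hc⟩ := exists_isComplexConjugation (Rat.castHom ℝ)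
  have hcR : c ∉ ((absGaloisRestrict ℚ F).range : Subgroup (absoluteGaloisGroup ℚ)) :=
    Rat.not_mem_range_absGaloisRestrict_of_isComplexConjugation F hF hc
  have hc2 : c * c = 1 := by rw [← pow_two]; exact hc.sq_eq_one
  have hidx : ((absGaloisRestrict ℚ F).range : Subgroup (absoluteGaloisGroup ℚ)).index = 2 :=
    (SorensenPatching.index_range_absGaloisRestrict ℚ F).trans hdeg
  -- extend `ψ` across index two, invariant under `θ_c`
  obtain ⟨Φ, hΦres, hΦc⟩ := exists_extension_of_index_two (absGaloisRestrict ℚ F).toMonoidHom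
    (absGaloisRestrict_injective ℚ F) hidx hcR hc2 (absGaloisOuterConj ℚ F c)
    (fun m => absGaloisRestrict_absGaloisOuterConj ℚ F c m) ψ
    (fun m => hψ_inv c m _ (absGaloisRestrict_absGaloisOuterConj ℚ F c m))
  -- the odd extension `η₀ = ε_F · Φ`
  set ε : absoluteGaloisGroup ℚ →* (PadicAlgCl p)ˣ :=
    signCharOfIndexTwo (R := PadicAlgCl p) _ hidx with hε_def
  set η₀ : absoluteGaloisGroup ℚ →* (PadicAlgCl p)ˣ := ε * Φ with hη₀_def
  have hη₀ : ∀ g, η₀ g = ε g * Φ g := fun g => rfl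
  have hres_mem : ∀ σ, absGaloisRestrict ℚ F σ ∈
      ((absGaloisRestrict ℚ F).range : Subgroup (absoluteGaloisGroup ℚ)) := fun σ => ⟨σ, rfl⟩
  have hη₀_res : ∀ σ, η₀ (absGaloisRestrict ℚ F σ) = ψ σ := by
    intro σ
    rw [hη₀, hε_def, signCharOfIndexTwo_apply_of_mem hidx (hres_mem σ), one_mul]
    exact hΦres σ
  have hη₀_c : η₀ c = -1 := by
    rw [hη₀, hε_def, signCharOfIndexTwo_apply_of_not_mem hidx hcR, hΦc, mul_one]
  -- continuity: `η₀ = 1` on the neighbourhood `res(ker ψ̄)` of `1`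
  have hopen : IsOpenEmbedding (absGaloisRestrict ℚ F) :=
    ⟨(isClosedEmbedding_absGaloisRestrict ℚ F).isEmbedding,
      SorensenPatching.isOpen_range_absGaloisRestrict ℚ F⟩
  have hη₀_cont : Continuous η₀ := by
    apply continuous_of_continuousAt_one η₀
    have hmem : (absGaloisRestrict ℚ F) '' (ψbar.ker : Set (absoluteGaloisGroup F)) ∈
        nhds (1 : absoluteGaloisGroup ℚ) := by
      rw [← map_one (absGaloisRestrict ℚ F), ← hopen.map_nhds_eq]
      exact Filter.image_mem_map hker
    refine (continuousAt_const (y := (1 : (PadicAlgCl p)ˣ))).congr_of_eventuallyEq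
      (Filter.mem_of_superset hmem ?_)
    rintro _ ⟨σ, hσ, rfl⟩
    change η₀ (absGaloisRestrict ℚ F σ) = 1
    rw [hη₀_res, hψ_one σ hσ]
  refine ⟨{ toMonoidHom := η₀, continuous_toFun := hη₀_cont }, fun τ => ?_, fun σ => ?_,
    fun c' hc' => ?_⟩
  · -- unit-valued: `η₀ τ = ± ψ(σ)` for some `σ`
    change Valued.v ((η₀ τ : (PadicAlgCl p)ˣ) : PadicAlgCl p) = 1
    have hε_v : Valued.v ((ε τ : (PadicAlgCl p)ˣ) : PadicAlgCl p) = 1 := by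
      by_cases hτ : τ ∈ ((absGaloisRestrict ℚ F).range : Subgroup (absoluteGaloisGroup ℚ))
      · rw [hε_def, signCharOfIndexTwo_apply_of_mem hidx hτ, Units.val_one, map_one]
      · rw [hε_def, signCharOfIndexTwo_apply_of_not_mem hidx hτ, Units.val_neg, Units.val_one,
          Valuation.map_neg, map_one]
    have hΦ_v : Valued.v ((Φ τ : (PadicAlgCl p)ˣ) : PadicAlgCl p) = 1 := by
      by_cases hτ : τ ∈ ((absGaloisRestrict ℚ F).range : Subgroup (absoluteGaloisGroup ℚ))
      · obtain ⟨σ, hσ⟩ := hτ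
        rw [← hσ, hΦres σ, hψ_v]
      · have hcτ : c * τ ∈ ((absGaloisRestrict ℚ F).range : Subgroup (absoluteGaloisGroup ℚ)) :=
          (Subgroup.mul_mem_iff_of_index_two hidx).mpr (iff_of_false hcR hτ)
        obtain ⟨σ, hσ⟩ := hcτ
        have hΦτ : Φ τ = ψ σ := by
          rw [← hΦres σ, hσ, map_mul, hΦc, one_mul]
        rw [hΦτ, hψ_v]
    rw [hη₀, Units.val_mul, map_mul, hε_v, hΦ_v, one_mul]
  · -- the descent relation: `ψ(σ) a - d ≡ (d̄/ā) ā - d̄ = 0`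
    change Valued.v (((η₀ (absGaloisRestrict ℚ F σ) : (PadicAlgCl p)ˣ) : PadicAlgCl p) *
      ((ρ₀ σ).val 0 0 : PadicAlgCl p) - ((ρ₀ σ).val 1 1 : PadicAlgCl p)) < 1
    rw [hη₀_res, hψ_coe]
    have h : (((ψ₀ σ : O) * (ρ₀ σ).val 0 0 - (ρ₀ σ).val 1 1 : O) : PadicAlgCl p) =
        ((ψ₀ σ : O) : PadicAlgCl p) * ((ρ₀ σ).val 0 0 : PadicAlgCl p) - ((ρ₀ σ).val 1 1 : PadicAlgCl p) := by
      push_cast; rfl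
    rw [← h]
    apply v_lt_one_of_mem_maximalIdeal hO
    rw [← residue_eq_zero_iff, map_sub, map_mul, hψ_res, hψbar, ← hχa, ← hχb, Units.val_div_eq_div_val,
      div_mul_cancel₀ _ (χa σ).ne_zero, sub_self]
  · -- oddness at every complex conjugation: `c'` is conjugate to `c`
    change Valued.v (((η₀ c' : (PadicAlgCl p)ˣ) : PadicAlgCl p) + 1) < 1
    obtain ⟨u, hu⟩ := isConj_iff.mp (hc.isConj hc')
    have h : η₀ c' = -1 := by
      rw [← hu, map_mul, map_mul, map_inv, mul_inv_cancel_comm, hη₀_c]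
    rw [h, Units.val_neg, Units.val_one, neg_add_cancel, map_zero]
    exact zero_lt_one

end Descent

end Summit.Langlands.Langlands.Theorems.SkinnerWilesDefectOne.SeedOfQuadraticBaseChange

end
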